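import Mathlib
import Summits.MatrixMultiplication.MatrixMultiplication.Theses.NOFWindowCapacity

/-!
# Route NOFWindowCapacity — `TriangleBound` (W3: an alien-free window has `cells² ≤ |G|³`)

Closes item `stmt-MatrixMultiplication-7277`
(`Summit.MatrixMultiplication.MatrixMultiplication.Theses.NOFWindowCapacity.TriangleBound`).

Setting (route NOFWindowCapacity, after Cohn–Umans 2003 Lemma 3.1 and Alman–Blasiok 2023 §3.10):
a finite abelian group `G`, legs `s t u : Fin N → G` (X-entry `(i,j) ↦ t j - s i`, Y-entry
`(j,k) ↦ u k - t j`, output `(i,k) ↦ u k - s i`) and a box `P × Q × R` of pair sets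
(`P` output pairs `(i,k)`, `Q` X-pairs `(i,j)`, `R` Y-pairs `(j,k)`).  The box is ALIEN-FREE when
every triple `(a,b,c) ∈ P × Q × R` lying on the addition table (`leg b + leg c = leg a`) is a
matrix-multiplication triple (`a.1 = b.1`, `b.2 = c.1`, `a.2 = c.2`).  The CELLS of the box are the
MM triples `(i,j,k)` with `(i,k) ∈ P`, `(i,j) ∈ Q`, `(j,k) ∈ R`.

Proof of `cells² ≤ |G|³`:
* alien-freeness forces each leg map to be injective on the ACTIVE pairs (pairs occurring in some
  cell): a collision of two active pairs, combined with a cell through one of them, is a table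
  triple of the box, which alien-freeness identifies with that cell; hence each of the three
  active-pair sets has at most `|G|` elements (`alienFree_cells_card_sq_le`);
* the cells are then a finite subset of `[N]³` whose three coordinate-plane projections are the
  active-pair sets, and the discrete Loomis–Whitney / triangle-counting inequality
  `|C|² ≤ |π₁₃ C| · |π₁₂ C| · |π₂₃ C|` (`loomisWhitney_card_sq_le`, by a fibrewise count over
  `π₁₃ C`, Cauchy–Schwarz, and an injection of the squared fibres into `π₁₂ C × π₂₃ C`) gives
  `cells² ≤ |G|³`.

Only Mathlib finite-set counting is used (`Finset.card_eq_sum_card_image`,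
`sq_sum_le_card_mul_sum_sq`, `Finset.card_sigma`, `Finset.card_le_card_of_injOn`).
-/

-- single-conjunct summit: the mandated namespace repeats `MatrixMultiplication` (summit = sub-problem).
set_option linter.dupNamespace false

namespace Summit.MatrixMultiplication.MatrixMultiplication.Theorems

open Finset

/-- **Discrete Loomis–Whitney inequality in dimension three (triangle counting).**
For a finite set `C ⊆ α × β × γ`, writing `π₁₃`, `π₁₂`, `π₂₃` for the three coordinate-plane
projections, `|C|² ≤ |π₁₃ C| · (|π₁₂ C| · |π₂₃ C|)`.  Equivalently: a graph with `e₁, e₂, e₃` edges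
between the three pairs of parts of a tripartition has at most `√(e₁e₂e₃)` triangles.
Proof: `|C| = Σ_{p ∈ π₁₃ C} |fibre p|`; by Cauchy–Schwarz `|C|² ≤ |π₁₃ C| · Σ_p |fibre p|²`, and
`(p, x, y) ↦ (π₁₂ x, π₂₃ y)` injects the disjoint union of the squared fibres into
`π₁₂ C × π₂₃ C` (from `(x.1, x.2.1)`, `(y.2.1, y.2.2)` and `π₁₃ x = π₁₃ y = p` one recovers
`p = (x.1, y.2.2)`, then `x` and `y`). [folklore] -/
theorem loomisWhitney_card_sq_le {α β γ : Type*} [DecidableEq α] [DecidableEq β] [DecidableEq γ]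
    (C : Finset (α × β × γ)) :
    C.card ^ 2 ≤ (C.image fun x => (x.1, x.2.2)).card *
      ((C.image fun x => (x.1, x.2.1)).card * (C.image fun x => (x.2.1, x.2.2)).card) := by
  -- fibrewise count over the projection `π₁₃`
  have hcard : C.card = ∑ p ∈ C.image (fun x => (x.1, x.2.2)),
      (C.filter fun x => (x.1, x.2.2) = p).card :=
    card_eq_sum_card_image (fun x => (x.1, x.2.2)) C
  -- Cauchy–Schwarz
  have hCS := sq_sum_le_card_mul_sum_sq (s := C.image (fun x => (x.1, x.2.2)))
    (f := fun p => (C.filter fun x => (x.1, x.2.2) = p).card)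
  simp only [Nat.cast_id] at hCS
  -- the squared fibres inject into `π₁₂ C × π₂₃ C`
  have hinj : ∑ p ∈ C.image (fun x => (x.1, x.2.2)), (C.filter fun x => (x.1, x.2.2) = p).card ^ 2
      ≤ (C.image fun x => (x.1, x.2.1)).card * (C.image fun x => (x.2.1, x.2.2)).card := by
    calc ∑ p ∈ C.image (fun x => (x.1, x.2.2)), (C.filter fun x => (x.1, x.2.2) = p).card ^ 2
        = ∑ p ∈ C.image (fun x => (x.1, x.2.2)),
            ((C.filter fun x => (x.1, x.2.2) = p) ×ˢ (C.filter fun x => (x.1, x.2.2) = p)).card := by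
          refine Finset.sum_congr rfl fun p _ => ?_
          rw [card_product, sq]
      _ = ((C.image (fun x => (x.1, x.2.2))).sigma fun p =>
            (C.filter fun x => (x.1, x.2.2) = p) ×ˢ (C.filter fun x => (x.1, x.2.2) = p)).card :=
          (card_sigma _ _).symm
      _ ≤ ((C.image fun x => (x.1, x.2.1)) ×ˢ (C.image fun x => (x.2.1, x.2.2))).card := by
          refine card_le_card_of_injOn
            (fun z => ((z.2.1.1, z.2.1.2.1), (z.2.2.2.1, z.2.2.2.2))) ?_ ?_
          · rintro ⟨p, x, y⟩ hz
            rw [Finset.mem_coe, Finset.mem_sigma, Finset.mem_product, Finset.mem_filter,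
              Finset.mem_filter] at hz
            rw [Finset.mem_coe, Finset.mem_product]
            exact ⟨mem_image_of_mem _ hz.2.1.1, mem_image_of_mem _ hz.2.2.1⟩
          · rintro ⟨⟨i, k⟩, ⟨xi, xj, xk⟩, ⟨yi, yj, yk⟩⟩ hz ⟨⟨i', k'⟩, ⟨xi', xj', xk'⟩, ⟨yi', yj', yk'⟩⟩
              hz' h
            simp only [Finset.mem_coe, Finset.mem_sigma, Finset.mem_product, Finset.mem_filter,
              Prod.mk.injEq] at hz hz' h
            obtain ⟨-, ⟨-, h1, h2⟩, ⟨-, h3, h4⟩⟩ := hz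
            obtain ⟨-, ⟨-, h1', h2'⟩, ⟨-, h3', h4'⟩⟩ := hz'
            obtain ⟨⟨h5, h6⟩, ⟨h7, h8⟩⟩ := h
            subst_vars
            rfl
      _ = (C.image fun x => (x.1, x.2.1)).card * (C.image fun x => (x.2.1, x.2.2)).card :=
          card_product _ _
  calc C.card ^ 2
      = (∑ p ∈ C.image (fun x => (x.1, x.2.2)), (C.filter fun x => (x.1, x.2.2) = p).card) ^ 2 := by
        rw [hcard]
    _ ≤ (C.image fun x => (x.1, x.2.2)).card *
          ∑ p ∈ C.image (fun x => (x.1, x.2.2)), (C.filter fun x => (x.1, x.2.2) = p).card ^ 2 := hCS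
    _ ≤ (C.image fun x => (x.1, x.2.2)).card *
          ((C.image fun x => (x.1, x.2.1)).card * (C.image fun x => (x.2.1, x.2.2)).card) :=
        Nat.mul_le_mul_left _ hinj

/-- **Core of W3.**  In the setting of the module docstring: if the box `P × Q × R` is alien-free
for the legs `s, t, u : Fin N → G` and `C` is any finite set of cells of the box (triples `(i,j,k)`
with `(i,k) ∈ P`, `(i,j) ∈ Q`, `(j,k) ∈ R`), then `|C|² ≤ |G|³`.
Proof: the output leg `(i,k) ↦ u k - s i`, the X-leg `(i,j) ↦ t j - s i` and the Y-leg
`(j,k) ↦ u k - t j` are injective on the respective projections of `C` (a collision plus a cell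
through one of the two colliding pairs is a table triple of the box, which alien-freeness forces
to be that cell), so each projection has at most `|G|` elements; conclude by
`loomisWhitney_card_sq_le`.  (Cohn–Umans 2003, proof of Lemma 3.1; Alman–Blasiok 2023 §3.10.) -/
theorem alienFree_cells_card_sq_le {N : ℕ} {G : Type*} [AddCommGroup G] [Fintype G]
    (s t u : Fin N → G) (P Q R : Finset (Fin N × Fin N))
    (hAF : ∀ a ∈ P, ∀ b ∈ Q, ∀ c ∈ R, (t b.2 - s b.1) + (u c.2 - t c.1) = u a.2 - s a.1 →
      a.1 = b.1 ∧ b.2 = c.1 ∧ a.2 = c.2)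
    (C : Finset (Fin N × Fin N × Fin N))
    (hC : ∀ x ∈ C, (x.1, x.2.2) ∈ P ∧ (x.1, x.2.1) ∈ Q ∧ (x.2.1, x.2.2) ∈ R) :
    C.card ^ 2 ≤ Fintype.card G ^ 3 := by
  classical
  -- output leg injective on active output pairs
  have hP' : (C.image fun x => (x.1, x.2.2)).card ≤ Fintype.card G := by
    rw [← Finset.card_univ (α := G)]
    refine card_le_card_of_injOn (fun a => u a.2 - s a.1)
      (fun _ _ => Finset.mem_coe.2 (Finset.mem_univ _)) ?_
    intro a ha a' ha' h
    rw [Finset.mem_coe, Finset.mem_image] at ha ha'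
    obtain ⟨x, hx, rfl⟩ := ha
    obtain ⟨x', hx', rfl⟩ := ha'
    have h0 : u x.2.2 - s x.1 = u x'.2.2 - s x'.1 := h
    -- the cell `x` and the output pair of `x'` form a table triple of the box
    have h3 := hAF (x'.1, x'.2.2) (hC x' hx').1 (x.1, x.2.1) (hC x hx).2.1 (x.2.1, x.2.2)
      (hC x hx).2.2 (by
        show t x.2.1 - s x.1 + (u x.2.2 - t x.2.1) = u x'.2.2 - s x'.1
        rw [← h0]; abel)
    have h1 : x'.1 = x.1 := h3.1
    have h2 : x'.2.2 = x.2.2 := h3.2.2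
    show (x.1, x.2.2) = (x'.1, x'.2.2)
    rw [h1, h2]
  -- X-leg injective on active X-pairs
  have hQ' : (C.image fun x => (x.1, x.2.1)).card ≤ Fintype.card G := by
    rw [← Finset.card_univ (α := G)]
    refine card_le_card_of_injOn (fun b => t b.2 - s b.1)
      (fun _ _ => Finset.mem_coe.2 (Finset.mem_univ _)) ?_
    intro b hb b' hb' h
    rw [Finset.mem_coe, Finset.mem_image] at hb hb'
    obtain ⟨x, hx, rfl⟩ := hb
    obtain ⟨x', hx', rfl⟩ := hb'
    have h0 : t x.2.1 - s x.1 = t x'.2.1 - s x'.1 := h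
    -- the X-pair of `x` and the cell `x'` form a table triple of the box
    have h3 := hAF (x'.1, x'.2.2) (hC x' hx').1 (x.1, x.2.1) (hC x hx).2.1 (x'.2.1, x'.2.2)
      (hC x' hx').2.2 (by
        show t x.2.1 - s x.1 + (u x'.2.2 - t x'.2.1) = u x'.2.2 - s x'.1
        rw [h0]; abel)
    have h1 : x'.1 = x.1 := h3.1
    have h2 : x.2.1 = x'.2.1 := h3.2.1
    show (x.1, x.2.1) = (x'.1, x'.2.1)
    rw [h1, h2]
  -- Y-leg injective on active Y-pairs
  have hR' : (C.image fun x => (x.2.1, x.2.2)).card ≤ Fintype.card G := by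
    rw [← Finset.card_univ (α := G)]
    refine card_le_card_of_injOn (fun c => u c.2 - t c.1)
      (fun _ _ => Finset.mem_coe.2 (Finset.mem_univ _)) ?_
    intro c hc c' hc' h
    rw [Finset.mem_coe, Finset.mem_image] at hc hc'
    obtain ⟨x, hx, rfl⟩ := hc
    obtain ⟨x', hx', rfl⟩ := hc'
    have h0 : u x.2.2 - t x.2.1 = u x'.2.2 - t x'.2.1 := h
    -- the Y-pair of `x` and the cell `x'` form a table triple of the box
    have h3 := hAF (x'.1, x'.2.2) (hC x' hx').1 (x'.1, x'.2.1) (hC x' hx').2.1 (x.2.1, x.2.2)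
      (hC x hx).2.2 (by
        show t x'.2.1 - s x'.1 + (u x.2.2 - t x.2.1) = u x'.2.2 - s x'.1
        rw [h0]; abel)
    have h1 : x'.2.1 = x.2.1 := h3.2.1
    have h2 : x'.2.2 = x.2.2 := h3.2.2
    show (x.2.1, x.2.2) = (x'.2.1, x'.2.2)
    rw [h1, h2]
  calc C.card ^ 2
      ≤ (C.image fun x => (x.1, x.2.2)).card *
          ((C.image fun x => (x.1, x.2.1)).card * (C.image fun x => (x.2.1, x.2.2)).card) :=
        loomisWhitney_card_sq_le C
    _ ≤ Fintype.card G * (Fintype.card G * Fintype.card G) :=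
        Nat.mul_le_mul hP' (Nat.mul_le_mul hQ' hR')
    _ = Fintype.card G ^ 3 := by ring

/-- **W3 / `TriangleBound`** (item `stmt-MatrixMultiplication-7277` of route NOFWindowCapacity):
for every `N`, every finite abelian group `G`, all legs `s t u : Fin N → G` and every alien-free box
`P × Q × R`, the number of matrix-multiplication triples `(i,j,k)` in the box (`(i,k) ∈ P`,
`(i,j) ∈ Q`, `(j,k) ∈ R`) satisfies `cells² ≤ |G|³`.  Immediate from
`alienFree_cells_card_sq_le` applied to the full cell set. -/
theorem triangleBound_proof :
    Summit.MatrixMultiplication.MatrixMultiplication.Theses.NOFWindowCapacity.TriangleBound := by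
  unfold Summit.MatrixMultiplication.MatrixMultiplication.Theses.NOFWindowCapacity.TriangleBound
  intro N G _ _ s t u P Q R hAF
  exact alienFree_cells_card_sq_le s t u P Q R hAF _ (fun x hx => (Finset.mem_filter.1 hx).2)

end Summit.MatrixMultiplication.MatrixMultiplication.Theorems
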